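/-
Copyright: b2b-lace packet (literature seat, gen 11).  Glue between the tree's encodings of the
`n`-step law of simple random walk on `ℤ^d`: the path counts `SRW.count` / `SRW.prob`
(`LatticeModels/SRWReturnCounts`), the word displacements `wordPos` (`Percolation/DualContours`),
the convolution powers `convPow (srwStep d) n` (`Barriers/…/GaussianDominationRouteNoble`) and
the recursion `srwLaw` (`Barriers/…/RigorousRGSmallParameterFracLaplacian`).
-/
import Literature.Probability.LatticeModels.SRWReturnCounts
import Literature.Probability.Percolation.DualContours
import Literature.Barriers.CriticalPhenomena.GaussianDominationRouteGreen
import Literature.Barriers.CriticalPhenomena.RigorousRGSmallParameterFracLaplacian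
import HarnessLib

/-!
# The four encodings of the SRW transition function agree; word sums as `(2d)^n D^{⋆n}`

[FvdH17] §4.2 bounds the modified two-point functions by simple-random-walk quantities,
`τ_{m,p}(x) ≤ (2dp)^m (D^{⋆m} ⋆ τ_p)(x)` ((4.3)) and
`τ_{n,p}(x) ≤ Σ_{r=n}^{M-1} p^r a_r(x) + p^M (a_M ⋆ τ_p)(x)` ((4.18)), where `D(x) = 𝟙{|x|=1}/(2d)`
and "bond-avoiding walks are simple random walks that never use a bond twice", so that
`a_M(x) ≤ (2d)^M D^{⋆M}(x)` = the number of `M`-step walks `0 → x`.  The kernel versions of these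
displays (`TwoPointTrailExtraction`, `DoubleConnectionBubble`) produce finite sums over step WORDS
`w : Fin M → Fin d × Bool` of `f (wordPos w M)`; the Fourier-side bounds of the packet
(`SimpleDiagramFourierBound.srwConvTau_le_printed`) are stated for
`latticeConv (convPow (srwStep d) M) …`.  This file is the dictionary between the two, and at the
same time the bridge announced in the header of `LatticeModels/SRWReturnCounts.lean` between the
tree's encodings of `pₙ(x) = P(Sₙ = x)`:

* `prob_one_eq_srwStep`, **`prob_eq_convPow_srwStep`**: `SRW.prob d n = convPow (srwStep d) n`
  (all `d`, `n`; Chapman–Kolmogorov `prob_add` against `convPow f (n+1) = convPow f n ⋆ f`);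
* **`prob_eq_srwLaw`**: `SRW.prob d n = srwLaw d n` (first-step decomposition `count_one_add` and
  the splitting `Dir d = Fin d × Bool` of the `2d` steps into `±eⱼ`), hence
  `srwLaw_eq_convPow_srwStep`; with `srwP_eq_srwLaw` (`SrwIntegralMonotone`) all four encodings
  (`srwP`, `srwLaw`, `SRW.prob`, `convPow (srwStep d)`) are identified;
* `natCast_count_eq_pow_mul_convPow_srwStep`: `#{n-step walks 0 → x} = (2d)ⁿ D^{⋆n}(x)`;
* `wordPos_eq_pos`, `wordPos_eq_endpoint`: the word displacement of `Percolation/DualContours` is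
  the position / endpoint of `LatticeModels/SRWStepSequences`;
* **`sum_words_eq_pow_mul_latticeConv`**: `Σ_{w ∈ (Fin d × Bool)^M} f(x - w(M)) = (2d)^M (D^{⋆M} ⋆ f)(x)`,
  and the unshifted forms `sum_words_eq_sum_box_count`, `sum_words_eq_pow_mul_tsum`.

All statements hold for every `d` (for `d = 0` both sides degenerate consistently).

## References
* [FvdH17] R. Fitzner, R. van der Hofstad, Mean-field behavior for nearest-neighbor percolation in
  `d > 10`, Electron. J. Probab. 22 (2017) no. 43; arXiv:1506.07977v2 — §4.2, (4.3) and the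
  sentence after (4.18) ("Bond-avoiding walks are simple random walks that never use a bond twice").
* [HvdH17] M. Heydenreich, R. van der Hofstad, Progress in high-dimensional percolation and random
  graphs, Springer 2017 — (1.2.18) (`D`), (2.2.6) (`P(Σ_{i≤n} Yᵢ = x) = D^{⋆n}(x)`, the
  `n`-step transition probability as a convolution power).
* [Sla17] G. Slade, Critical exponents for long-range `O(n)` models below the upper critical
  dimension, Comm. Math. Phys. 358 (2018) 343–436 — Lemma 2.2.1 (the source of the tree's `srwLaw`).
-/

noncomputable section

namespace Literature.Probability.FitznerVanDerHofstad2017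

open Literature.Probability.Percolation
open Literature.Probability.LatticeModels
open Literature.Barriers.CriticalPhenomena
open Literature.Barriers.CriticalPhenomena.SpreadOutIsing (delta0 latticeConv convPow)
open scoped BigOperators

variable {d : ℕ}

/-! ### Words of `Percolation/DualContours` are step sequences of `LatticeModels/SRWStepSequences` -/

/-- The two unit-step maps of the tree agree (`rfl`). [folklore] -/
theorem stepVec_eq_srwStepVec (a : Fin d × Bool) : stepVec a = SRW.stepVec a := rfl

/-- `wordPos w k = SRW.pos w k` for `k ≤ n`. [folklore] -/
theorem wordPos_eq_pos {n : ℕ} (w : Fin n → Fin d × Bool) {k : ℕ} (hk : k ≤ n) :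
    wordPos w k = SRW.pos w k := by
  rw [SRW.pos_eq_sum_range w hk]; rfl

/-- `wordPos w n` is the endpoint of the step sequence `w`. [folklore] -/
theorem wordPos_eq_endpoint {n : ℕ} (w : Fin n → Fin d × Bool) : wordPos w n = SRW.endpoint w := by
  rw [wordPos_eq_pos w le_rfl, SRW.pos_eq_endpoint]

/-! ### One step: `count d 1 = 𝟙{|x| = 1}`, `prob d 1 = D` -/

/-- `#{1-step walks 0 → x} = 𝟙{x ~ 0}`. [folklore] -/
theorem count_one_eq (x : Site d) : SRW.count d 1 x = if (zdGraph d).Adj 0 x then 1 else 0 := by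
  classical
  have h := SRW.count_one_add (d := d) 0 x
  rw [Nat.add_zero] at h
  rw [h]
  simp_rw [SRW.count_zero, sub_eq_zero]
  by_cases hx : (zdGraph d).Adj 0 x
  · obtain ⟨v, hv⟩ := SRW.exists_dir_of_adj hx
    rw [zero_add] at hv
    rw [if_pos hx, Finset.sum_eq_single v]
    · rw [if_pos hv]
    · intro w _ hw
      rw [if_neg]
      intro h'
      exact hw (SRW.stepVec_injective (h'.symm.trans hv))
    · intro h'
      exact absurd (Finset.mem_univ v) h'
  · rw [if_neg hx]
    refine Finset.sum_eq_zero fun v _ => if_neg fun h' => hx ?_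
    rw [h', ← zero_add (SRW.stepVec v)]
    exact SRW.adj_add_stepVec 0 v

/-- **`p₁ = D`**: `SRW.prob d 1 x = srwStep d x = 𝟙{|x|=1}/(2d)`.
[cite: FitznerVanDerHofstad2017, §1.3 (D(x) = 𝟙{|x|=1}/(2d)); §4.2 (4.3) arXiv:1506.07977v2 p. 34 = EJP p. 32] -/
theorem prob_one_eq_srwStep (x : Site d) : SRW.prob d 1 x = srwStep d x := by
  rw [SRW.prob, count_one_eq, pow_one]
  unfold srwStep
  split_ifs <;> simp

/-! ### `SRW.prob d n = convPow (srwStep d) n = srwLaw d n` -/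

/-- **Bridge 1**: the path-count law `pₙ(x) = #{n-step walks 0 → x}/(2d)ⁿ` is the `n`-fold
convolution power `D^{⋆n}(x)` (Chapman–Kolmogorov against `D^{⋆(n+1)} = D^{⋆n} ⋆ D`).
[cite: HeydenreichVanDerHofstad2017, (2.2.6) (P(Σ_{i≤n} Yᵢ = x) = D^{⋆n}(x)) with (1.2.18) (D)] -/
theorem prob_eq_convPow_srwStep : ∀ (n : ℕ) (x : Site d), SRW.prob d n x = convPow (srwStep d) n x
  | 0, x => by
    rw [SRW.prob_zero]
    show _ = delta0 x
    rfl
  | n + 1, x => by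
    rw [SRW.prob_add n 1 x]
    show _ = latticeConv (convPow (srwStep d) n) (srwStep d) x
    rw [latticeConv, tsum_eq_sum (s := box d n)]
    · exact Finset.sum_congr rfl fun y _ => by
        rw [prob_eq_convPow_srwStep n y, prob_one_eq_srwStep]
    · intro y hy
      rw [← prob_eq_convPow_srwStep n y, SRW.prob_eq_zero_of_not_mem_box hy, zero_mul]

/-- `D^{⋆n}` vanishes off `box d n`. [folklore] -/
theorem convPow_srwStep_eq_zero_of_not_mem_box {n : ℕ} {x : Site d} (hx : x ∉ box d n) :
    convPow (srwStep d) n x = 0 := by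
  rw [← prob_eq_convPow_srwStep, SRW.prob_eq_zero_of_not_mem_box hx]

/-- `#{n-step walks 0 → x} = (2d)ⁿ pₙ(x)` (also for `d = 0`, where both sides vanish for
`n ≥ 1`). [folklore] -/
theorem natCast_count_eq_pow_mul_prob (n : ℕ) (x : Site d) :
    (SRW.count d n x : ℝ) = (2 * d : ℝ) ^ n * SRW.prob d n x := by
  by_cases h : (2 * d : ℝ) ^ n = 0
  · have h' : (2 * d) ^ n = 0 := by exact_mod_cast h
    have hc : SRW.count d n x = 0 := by
      by_cases hx : x ∈ box d n
      · have hle := (Finset.single_le_sum (fun y _ => Nat.zero_le (SRW.count d n y)) hx).trans_eq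
          (SRW.sum_box_count d n)
        omega
      · exact SRW.count_eq_zero_of_not_mem_box hx
    rw [hc, h, Nat.cast_zero, zero_mul]
  · rw [SRW.prob, ← mul_div_assoc, mul_comm ((2 * d : ℝ) ^ n), mul_div_assoc, div_self h, mul_one]

/-- **`#{n-step walks 0 → x} = (2d)ⁿ D^{⋆n}(x)`** — the identity behind "(2dp)^m (D^{⋆m} ⋆ τ_p)"
in [FvdH17] (4.3) and behind `a_M ≤ (2d)^M D^{⋆M}` after (4.18).
[cite: FitznerVanDerHofstad2017, §4.2 (4.3) arXiv:1506.07977v2 p. 34 = EJP p. 32] -/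
theorem natCast_count_eq_pow_mul_convPow_srwStep (n : ℕ) (x : Site d) :
    (SRW.count d n x : ℝ) = (2 * d : ℝ) ^ n * convPow (srwStep d) n x := by
  rw [natCast_count_eq_pow_mul_prob, prob_eq_convPow_srwStep]

/-- First-step form of `p_{n+1}`: `p_{n+1}(x) = (2d)⁻¹ Σ_v pₙ(x - e_v)`. [folklore] -/
theorem prob_succ_eq_sum_dir (n : ℕ) (x : Site d) :
    SRW.prob d (n + 1) x = (∑ v : SRW.Dir d, SRW.prob d n (x - SRW.stepVec v)) / (2 * d) := by
  unfold SRW.prob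
  rw [show n + 1 = 1 + n from Nat.add_comm _ _, SRW.count_one_add, Nat.cast_sum, Finset.sum_div,
    Finset.sum_div]
  refine Finset.sum_congr rfl fun v _ => ?_
  rw [pow_add, pow_one]
  ring

/-- **Bridge 2**: the path-count law is the recursively defined `srwLaw`
(`p₀ = δ₀`, `p_{n+1}(x) = (2d)⁻¹ Σⱼ (pₙ(x+eⱼ) + pₙ(x-eⱼ))`). [cite: Slade2017, Lemma 2.2.1 (the matrix J/2d)] -/
theorem prob_eq_srwLaw : ∀ (n : ℕ) (x : Site d), SRW.prob d n x = LongRangePhi4.srwLaw d n x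
  | 0, x => by rw [SRW.prob_zero, LongRangePhi4.srwLaw_zero_apply]
  | n + 1, x => by
    rw [prob_succ_eq_sum_dir, LongRangePhi4.srwLaw_succ_apply, Fintype.sum_prod_type]
    congr 1
    refine Finset.sum_congr rfl fun j _ => ?_
    rw [Fintype.sum_bool]
    simp only [SRW.stepVec, if_true, Bool.false_eq_true, if_false, sub_neg_eq_add]
    rw [prob_eq_srwLaw n, prob_eq_srwLaw n, add_comm]

/-- Hence `srwLaw d n = D^{⋆n}`. [folklore] -/
theorem srwLaw_eq_convPow_srwStep (n : ℕ) (x : Site d) :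
    LongRangePhi4.srwLaw d n x = convPow (srwStep d) n x := by
  rw [← prob_eq_srwLaw, prob_eq_convPow_srwStep]

/-! ### Word sums -/

/-- Grouping words by their endpoint: `Σ_w f(w(n)) = Σ_{x ∈ box d n} #{walks 0 → x} • f x`.
[folklore] -/
theorem sum_words_eq_sum_box_count {M : Type*} [AddCommMonoid M] (n : ℕ) (f : Site d → M) :
    ∑ w : Fin n → Fin d × Bool, f (wordPos w n) = ∑ x ∈ box d n, SRW.count d n x • f x := by
  simp_rw [wordPos_eq_endpoint]
  exact SRW.sum_stepSeq_eq_sum_box_count f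

/-- `Σ_w f(w(n)) = (2d)ⁿ Σ_{x ∈ box d n} D^{⋆n}(x) f(x)`. [folklore] -/
theorem sum_words_eq_pow_mul_sum_box (n : ℕ) (f : Site d → ℝ) :
    ∑ w : Fin n → Fin d × Bool, f (wordPos w n) =
      (2 * d : ℝ) ^ n * ∑ x ∈ box d n, convPow (srwStep d) n x * f x := by
  rw [sum_words_eq_sum_box_count, Finset.mul_sum]
  refine Finset.sum_congr rfl fun x _ => ?_
  rw [nsmul_eq_mul, natCast_count_eq_pow_mul_convPow_srwStep, mul_assoc]

/-- `Σ_w f(w(n)) = (2d)ⁿ Σ_x D^{⋆n}(x) f(x)`. [folklore] -/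
theorem sum_words_eq_pow_mul_tsum (n : ℕ) (f : Site d → ℝ) :
    ∑ w : Fin n → Fin d × Bool, f (wordPos w n) =
      (2 * d : ℝ) ^ n * ∑' x, convPow (srwStep d) n x * f x := by
  rw [sum_words_eq_pow_mul_sum_box, tsum_eq_sum (s := box d n)]
  intro x hx
  rw [convPow_srwStep_eq_zero_of_not_mem_box hx, zero_mul]

/-- **Word sums are SRW convolutions**: `Σ_{w ∈ (Fin d × Bool)ⁿ} f(x - w(n)) = (2d)ⁿ (D^{⋆n} ⋆ f)(x)`
— the step from the word form of [FvdH17] (4.18)/(4.20) (`Σ_{u ∈ trailWords} τ_p(x - u(M)) ≤ Σ_{all words}`)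
to the printed `(2dp)^M (D^{⋆M} ⋆ τ_p)(x)` of (4.3).
[cite: FitznerVanDerHofstad2017, §4.2 (4.3) arXiv:1506.07977v2 p. 34 = EJP p. 32; sentence after (4.18) arXiv:1506.07977v2 p. 36 = EJP p. 33] -/
theorem sum_words_eq_pow_mul_latticeConv (n : ℕ) (f : Site d → ℝ) (x : Site d) :
    ∑ w : Fin n → Fin d × Bool, f (x - wordPos w n) =
      (2 * d : ℝ) ^ n * latticeConv (convPow (srwStep d) n) f x := by
  rw [latticeConv]
  exact sum_words_eq_pow_mul_tsum n (fun y => f (x - y))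

end Literature.Probability.FitznerVanDerHofstad2017

end
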